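import Mathlib.Tactic
import HarnessLib
import HarnessLib.Audit.Tags
import Summits.CriticalPhenomena.PercolationContinuityZ3.Theorems.PercNearOneGluingNoHeavyLowerTailSahiAntichainSplitStep

/-!
# Antichains, meets plus joins: triples through a member — the combinatorics behind the `C([4],2)` structure theorem

Support file (seat `prim-masterthm-p1`, gen 38; `--supports stmt-CriticalPhenomena-4575`).  No `sorry`, no new definitions, standard
axioms.  Memo `run/shared/lean/prim/prim-masterthm/FROM-prim-masterthm-p1-g38-BLOWUP-SIDE.md` §5.

SETTING: a six-member antichain `A` in which every effective point `s` has exactly three members above it (`h3`), forming a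
SUNFLOWER with core `M_s` (`hS`; both hold when `#meets A + #joins A ≤ 11`, files `…SixPrep`, `…SixShape`).  Call `above A s` the
TRIPLE of `s`.

NEW HERE ([this work], gen 38) — the triples behave like the four 3-subsets `{ij, ik, il}` of `C([4],2)`:
* `above_eq_of_mem_core`: a point of the core `M_s` (outside the common part) has the same triple as `s`;
* `eq_of_mem_two_above`: two different triples through a member `d` share only `d`;
* `exists_sixth`: two such triples cover five members, leaving a unique sixth member `e`;
* `false_of_third_triple`: there is no third triple through `d`; hence (`eq_union_cores`) **`d` is the union of the cores of its two
  triples**, and (`forall_mem_of_mem_inter_sixth`) `d ∩ e` lies in every member;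
* `exists_two_triples`: every member lies in two different triples;
* `blowup_of_four_triples`: the generic assembly — four effective points with pairwise different triples, a set `K` inside every
  member containing all common points, every member in two of the four triples and every two triples sharing a member, give the
  blow-up presentation `a ∈ A ↔ ∃ i ≠ j, a = K ∪ B i ∪ B j` with blocks `B i = M i \ K` non-empty, pairwise disjoint, disjoint from `K`.
The companion file `…SixBlowup` picks the four points and concludes L4 and V5.
HONEST FRAMING: unconditional lemmas. [this work]
-/

namespace Summit.CriticalPhenomena.PercolationContinuityZ3.Theorems.SahiColouredDaykin

open Finset

variable {α : Type*} [DecidableEq α]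

section Triples

variable {A : Finset (Finset α)}

/-- The core of a triple lies in each of its members. [this work] -/
theorem core_subset_of_three {p : α} {M : Finset α} (h3p : #(above A p) = 3)
    (hM : ∀ a ∈ above A p, ∀ a' ∈ above A p, a ≠ a' → a ∩ a' = M) {d : Finset α} (hd : d ∈ above A p) : M ⊆ d := by
  obtain ⟨d', hd', hne⟩ := exists_mem_ne (by omega : 1 < #(above A p)) d
  rw [← hM d hd d' hd' hne.symm]; exact inter_subset_left

/-- A point whose triple is the triple of `p` lies in the core of `p` (in particular `p` itself). [this work] -/
theorem mem_core_of_above_eq {p z : α} {M : Finset α} (h3p : #(above A p) = 3)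
    (hM : ∀ a ∈ above A p, ∀ a' ∈ above A p, a ≠ a' → a ∩ a' = M) (he : above A z = above A p) : z ∈ M := by
  obtain ⟨d, d', hd, hd', hne⟩ := one_lt_card_iff.1 (by omega : 1 < #(above A p))
  rw [← hM d hd d' hd' hne]
  rw [← he] at hd hd'
  exact mem_inter.2 ⟨(mem_above_iff.1 hd).2, (mem_above_iff.1 hd').2⟩

/-- **A core point has the same triple.** [this work] -/
theorem above_eq_of_mem_core (h3 : ∀ s ∈ effPoints A, #(above A s) = 3) {p z : α} {M : Finset α} (hp : p ∈ effPoints A)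
    (hM : ∀ a ∈ above A p, ∀ a' ∈ above A p, a ≠ a' → a ∩ a' = M) (hz : z ∈ M) (hzE : z ∈ effPoints A) :
    above A z = above A p := by
  symm
  apply eq_of_subset_of_card_le
  · intro d hd
    exact mem_above_iff.2 ⟨above_subset A p hd, core_subset_of_three (h3 p hp) hM hd hz⟩
  · rw [h3 z hzE, h3 p hp]

/-- **Two different triples through `d` share only `d`.** [this work] -/
theorem eq_of_mem_two_above (h3 : ∀ s ∈ effPoints A, #(above A s) = 3) {p q : α} {Mp Mq : Finset α}
    (hp : p ∈ effPoints A) (hq : q ∈ effPoints A)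
    (hMp : ∀ a ∈ above A p, ∀ a' ∈ above A p, a ≠ a' → a ∩ a' = Mp)
    (hMq : ∀ a ∈ above A q, ∀ a' ∈ above A q, a ≠ a' → a ∩ a' = Mq)
    {d b : Finset α} (hdp : d ∈ above A p) (hdq : d ∈ above A q) (hne : above A p ≠ above A q)
    (hbp : b ∈ above A p) (hbq : b ∈ above A q) : b = d := by
  by_contra hbd
  have e1 : d ∩ b = Mp := hMp d hdp b hbp (Ne.symm hbd)
  have e2 : d ∩ b = Mq := hMq d hdq b hbq (Ne.symm hbd)
  have hpM : p ∈ Mq := by rw [← e2, e1]; exact mem_core_of_above_eq (h3 p hp) hMp rfl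
  exact hne (above_eq_of_mem_core h3 hq hMq hpM hp)

/-- **The sixth member.**  If two triples share exactly the member `d`, the remaining member of a six-member family is unique. [this work] -/
theorem exists_sixth (h6 : #A = 6) {p q : α} (h3p : #(above A p) = 3) (h3q : #(above A q) = 3) {d : Finset α}
    (hdp : d ∈ above A p) (hdq : d ∈ above A q) (honly : ∀ b ∈ above A p, b ∈ above A q → b = d) :
    ∃ e ∈ A, e ∉ above A p ∧ e ∉ above A q ∧ ∀ g ∈ A, g ∉ above A p → g ∉ above A q → g = e := by
  have hinter : above A p ∩ above A q = {d} := by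
    ext b; rw [mem_inter, mem_singleton]
    exact ⟨fun h => honly b h.1 h.2, fun h => by rw [h]; exact ⟨hdp, hdq⟩⟩
  have hU : #(above A p ∪ above A q) = 5 := by
    have := card_union_add_card_inter (above A p) (above A q)
    rw [hinter, card_singleton, h3p, h3q] at this; omega
  have hsub : above A p ∪ above A q ⊆ A := union_subset (above_subset A p) (above_subset A q)
  have hD : #(A \ (above A p ∪ above A q)) = 1 := by
    have := card_sdiff_add_card_eq_card hsub; omega
  obtain ⟨e, he⟩ := card_eq_one.1 hD
  have heD : e ∈ A \ (above A p ∪ above A q) := by rw [he]; exact mem_singleton_self e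
  obtain ⟨heA, heU⟩ := mem_sdiff.1 heD
  rw [mem_union, not_or] at heU
  refine ⟨e, heA, heU.1, heU.2, fun g hg hgp hgq => ?_⟩
  have : g ∈ A \ (above A p ∪ above A q) := mem_sdiff.2 ⟨hg, by rw [mem_union, not_or]; exact ⟨hgp, hgq⟩⟩
  rw [he] at this; exact mem_singleton.1 this

/-- **No third triple through `d`.** [this work] -/
theorem false_of_third_triple (h6 : #A = 6) (h3 : ∀ s ∈ effPoints A, #(above A s) = 3)
    (hS : ∀ s ∈ effPoints A, ∃ M, ∀ a ∈ above A s, ∀ a' ∈ above A s, a ≠ a' → a ∩ a' = M)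
    {p q z : α} {Mp Mq : Finset α} (hp : p ∈ effPoints A) (hq : q ∈ effPoints A) (hz : z ∈ effPoints A)
    (hMp : ∀ a ∈ above A p, ∀ a' ∈ above A p, a ≠ a' → a ∩ a' = Mp)
    (hMq : ∀ a ∈ above A q, ∀ a' ∈ above A q, a ≠ a' → a ∩ a' = Mq)
    {d : Finset α} (hdp : d ∈ above A p) (hdq : d ∈ above A q) (hdz : d ∈ above A z) (hne : above A p ≠ above A q)
    (nzp : above A z ≠ above A p) (nzq : above A z ≠ above A q) : False := by
  obtain ⟨Mz, hMz⟩ := hS z hz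
  have honly : ∀ b ∈ above A p, b ∈ above A q → b = d :=
    fun b hbp hbq => eq_of_mem_two_above h3 hp hq hMp hMq hdp hdq hne hbp hbq
  obtain ⟨e, _, hep, heq, huniq⟩ := exists_sixth h6 (h3 p hp) (h3 q hq) hdp hdq honly
  have cls : ∀ g ∈ above A z, g = d ∨ g = e := by
    intro g hg
    by_cases hgd : g = d
    · exact Or.inl hgd
    · right
      apply huniq g (above_subset A z hg)
      · exact fun hgp => hgd (eq_of_mem_two_above h3 hz hp hMz hMp hdz hdp nzp hg hgp)
      · exact fun hgq => hgd (eq_of_mem_two_above h3 hz hq hMz hMq hdz hdq nzq hg hgq)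
  have hsub : above A z ⊆ {d, e} := fun g hg => by rw [mem_insert, mem_singleton]; exact cls g hg
  have := (card_le_card hsub).trans (card_le_two (a := d) (b := e))
  have := h3 z hz
  omega

/-- **A member is the union of the cores of its two triples.** [this work] -/
theorem eq_union_cores (h6 : #A = 6) (h3 : ∀ s ∈ effPoints A, #(above A s) = 3)
    (hS : ∀ s ∈ effPoints A, ∃ M, ∀ a ∈ above A s, ∀ a' ∈ above A s, a ≠ a' → a ∩ a' = M)
    {p q : α} {Mp Mq : Finset α} (hp : p ∈ effPoints A) (hq : q ∈ effPoints A)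
    (hMp : ∀ a ∈ above A p, ∀ a' ∈ above A p, a ≠ a' → a ∩ a' = Mp)
    (hMq : ∀ a ∈ above A q, ∀ a' ∈ above A q, a ≠ a' → a ∩ a' = Mq)
    {d : Finset α} (hdp : d ∈ above A p) (hdq : d ∈ above A q) (hne : above A p ≠ above A q) : d = Mp ∪ Mq := by
  apply Subset.antisymm
  · intro z hz
    by_contra hzM
    rw [mem_union, not_or] at hzM
    -- some member avoids `z` (else `z` lies in the core `Mp = d ∩ b`)
    have hzE : z ∈ effPoints A := by
      rw [mem_effPoints_iff]
      refine ⟨⟨d, mem_above_iff.2 ⟨above_subset A p hdp, hz⟩⟩, ?_⟩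
      by_contra hB
      rw [not_nonempty_iff_eq_empty] at hB
      apply hzM.1
      obtain ⟨b, hbp, hbd⟩ := exists_mem_ne (by rw [h3 p hp]; omega) d
      rw [← hMp d hdp b hbp hbd.symm]
      refine mem_inter.2 ⟨hz, ?_⟩
      by_contra hzb
      have : b ∈ below A z := mem_below_iff.2 ⟨above_subset A p hbp, hzb⟩
      rw [hB] at this; exact notMem_empty _ this
    have hdz : d ∈ above A z := mem_above_iff.2 ⟨above_subset A p hdp, hz⟩
    exact false_of_third_triple h6 h3 hS hp hq hzE hMp hMq hdp hdq hdz hne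
      (fun he => hzM.1 (mem_core_of_above_eq (h3 p hp) hMp he))
      (fun he => hzM.2 (mem_core_of_above_eq (h3 q hq) hMq he))
  · exact union_subset (core_subset_of_three (h3 p hp) hMp hdp) (core_subset_of_three (h3 q hq) hMq hdq)

/-- **The antipode.**  With `e` the sixth member for the two triples through `d`, the set `d ∩ e` lies in every member. [this work] -/
theorem forall_mem_of_mem_inter_sixth (h6 : #A = 6) (h3 : ∀ s ∈ effPoints A, #(above A s) = 3)
    (hS : ∀ s ∈ effPoints A, ∃ M, ∀ a ∈ above A s, ∀ a' ∈ above A s, a ≠ a' → a ∩ a' = M)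
    {p q : α} {Mp Mq : Finset α} (hp : p ∈ effPoints A) (hq : q ∈ effPoints A)
    (hMp : ∀ a ∈ above A p, ∀ a' ∈ above A p, a ≠ a' → a ∩ a' = Mp)
    (hMq : ∀ a ∈ above A q, ∀ a' ∈ above A q, a ≠ a' → a ∩ a' = Mq)
    {d e : Finset α} (hdp : d ∈ above A p) (hdq : d ∈ above A q) (hne : above A p ≠ above A q)
    (heA : e ∈ A) (hep : e ∉ above A p) (heq : e ∉ above A q) {z : α} (hzd : z ∈ d) (hze : z ∈ e) :
    ∀ g ∈ A, z ∈ g := by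
  intro g hg
  by_contra hzg
  have hzE : z ∈ effPoints A := mem_effPoints_iff.2
    ⟨⟨d, mem_above_iff.2 ⟨above_subset A p hdp, hzd⟩⟩, ⟨g, mem_below_iff.2 ⟨hg, hzg⟩⟩⟩
  have hdz : d ∈ above A z := mem_above_iff.2 ⟨above_subset A p hdp, hzd⟩
  have hez : e ∈ above A z := mem_above_iff.2 ⟨heA, hze⟩
  exact false_of_third_triple h6 h3 hS hp hq hzE hMp hMq hdp hdq hdz hne
    (fun he => hep (he ▸ hez)) (fun he => heq (he ▸ hez))

/-- **Every member lies in two different triples.** [this work] -/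
theorem exists_two_triples (hanti : IsAntichain (· ⊆ ·) (A : Set (Finset α))) (h6 : #A = 6)
    (h3 : ∀ s ∈ effPoints A, #(above A s) = 3)
    (hS : ∀ s ∈ effPoints A, ∃ M, ∀ a ∈ above A s, ∀ a' ∈ above A s, a ≠ a' → a ∩ a' = M)
    {d : Finset α} (hd : d ∈ A) :
    ∃ p q : α, p ∈ effPoints A ∧ q ∈ effPoints A ∧ d ∈ above A p ∧ d ∈ above A q ∧ above A p ≠ above A q := by
  obtain ⟨d', hd', hne⟩ := exists_mem_ne (by omega : 1 < #A) d
  have hnot : ¬ d ⊆ d' := hanti (mem_coe.2 hd) (mem_coe.2 hd') hne.symm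
  obtain ⟨p, hpd, hpd'⟩ := not_subset.1 hnot
  have hp : p ∈ effPoints A := mem_effPoints_iff.2
    ⟨⟨d, mem_above_iff.2 ⟨hd, hpd⟩⟩, ⟨d', mem_below_iff.2 ⟨hd', hpd'⟩⟩⟩
  have hdp : d ∈ above A p := mem_above_iff.2 ⟨hd, hpd⟩
  obtain ⟨Mp, hMp⟩ := hS p hp
  -- a second member `b` of the triple, and a point `q ∈ d \ b`
  obtain ⟨b, hbp, hbd⟩ := exists_mem_ne (by rw [h3 p hp]; omega) d
  have hbA := above_subset A p hbp
  have hnot' : ¬ d ⊆ b := hanti (mem_coe.2 hd) (mem_coe.2 hbA) hbd.symm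
  obtain ⟨q, hqd, hqb⟩ := not_subset.1 hnot'
  have hq : q ∈ effPoints A := mem_effPoints_iff.2
    ⟨⟨d, mem_above_iff.2 ⟨hd, hqd⟩⟩, ⟨b, mem_below_iff.2 ⟨hbA, hqb⟩⟩⟩
  refine ⟨p, q, hp, hq, hdp, mem_above_iff.2 ⟨hd, hqd⟩, fun he => hqb ?_⟩
  have : b ∈ above A q := he ▸ hbp
  exact (mem_above_iff.1 this).2

/-! ### The generic assembly -/

/-- **Blow-up presentation from four triples.**  Four effective points `p i` with pairwise different triples and cores `M i`; a set
`K` contained in every member and containing every common point, avoided by the `p i`; every member in two of the triples, and every two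
triples with a common member.  Then `A = {K ∪ B i ∪ B j : i ≠ j}` for the blocks `B i = M i \ K`, which are non-empty, pairwise disjoint
and disjoint from `K`. [this work] -/
theorem blowup_of_four_triples (h6 : #A = 6) (h3 : ∀ s ∈ effPoints A, #(above A s) = 3)
    (hS : ∀ s ∈ effPoints A, ∃ M, ∀ a ∈ above A s, ∀ a' ∈ above A s, a ≠ a' → a ∩ a' = M)
    (p : Fin 4 → α) (M : Fin 4 → Finset α) (hp : ∀ i, p i ∈ effPoints A)
    (hM : ∀ i, ∀ a ∈ above A (p i), ∀ a' ∈ above A (p i), a ≠ a' → a ∩ a' = M i)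
    (hT : ∀ i j, i ≠ j → above A (p i) ≠ above A (p j))
    (K : Finset α) (hKsub : ∀ g ∈ A, K ⊆ g) (hKall : ∀ x, (∀ g ∈ A, x ∈ g) → x ∈ K) (hpK : ∀ i, p i ∉ K)
    (hcover : ∀ d ∈ A, ∃ i j, i ≠ j ∧ d ∈ above A (p i) ∧ d ∈ above A (p j))
    (hmeet : ∀ i j, i ≠ j → ∃ d, d ∈ above A (p i) ∧ d ∈ above A (p j)) :
    (∀ i, (M i \ K).Nonempty) ∧ (∀ i, Disjoint K (M i \ K)) ∧ (∀ i j, i ≠ j → Disjoint (M i \ K) (M j \ K)) ∧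
      (∀ a, a ∈ A ↔ ∃ i j, i ≠ j ∧ a = K ∪ (M i \ K) ∪ (M j \ K)) := by
  -- `K ⊆ M i`, and the presentation of a member of two triples
  have hKM : ∀ i, K ⊆ M i := by
    intro i
    obtain ⟨d, d', hd, hd', hne⟩ := one_lt_card_iff.1 (by rw [h3 _ (hp i)]; omega : 1 < #(above A (p i)))
    rw [← hM i d hd d' hd' hne]
    exact subset_inter (hKsub d (above_subset A _ hd)) (hKsub d' (above_subset A _ hd'))
  have pres : ∀ i j, K ∪ (M i \ K) ∪ (M j \ K) = M i ∪ M j := by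
    intro i j
    ext z
    simp only [mem_union, mem_sdiff]
    constructor
    · rintro ((h | ⟨h, _⟩) | ⟨h, _⟩)
      · exact Or.inl (hKM i h)
      · exact Or.inl h
      · exact Or.inr h
    · rintro (h | h)
      · by_cases hzK : z ∈ K
        · exact Or.inl (Or.inl hzK)
        · exact Or.inl (Or.inr ⟨h, hzK⟩)
      · by_cases hzK : z ∈ K
        · exact Or.inl (Or.inl hzK)
        · exact Or.inr ⟨h, hzK⟩
  have memb : ∀ {i j : Fin 4} {d : Finset α}, i ≠ j → d ∈ above A (p i) → d ∈ above A (p j) → d = M i ∪ M j :=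
    fun {i j d} hij hdi hdj => eq_union_cores h6 h3 hS (hp i) (hp j) (hM i) (hM j) hdi hdj (hT i j hij)
  refine ⟨fun i => ⟨p i, mem_sdiff.2 ⟨mem_core_of_above_eq (h3 _ (hp i)) (hM i) rfl, hpK i⟩⟩,
    fun i => disjoint_sdiff, fun i j hij => ?_, fun a => ⟨fun ha => ?_, ?_⟩⟩
  · -- pairwise disjoint blocks: a common point outside `K` would have both triples
    rw [disjoint_left]
    intro z hzi hzj
    obtain ⟨hzi, hzK⟩ := mem_sdiff.1 hzi
    obtain ⟨hzj, _⟩ := mem_sdiff.1 hzj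
    have hzE : z ∈ effPoints A := by
      rw [mem_effPoints_iff]
      obtain ⟨d, hd⟩ : (above A (p i)).Nonempty := card_pos.1 (by rw [h3 _ (hp i)]; omega)
      refine ⟨⟨d, mem_above_iff.2 ⟨above_subset A _ hd, core_subset_of_three (h3 _ (hp i)) (hM i) hd hzi⟩⟩, ?_⟩
      by_contra hB
      rw [not_nonempty_iff_eq_empty] at hB
      apply hzK; apply hKall
      intro g hg
      by_contra hzg
      have : g ∈ below A z := mem_below_iff.2 ⟨hg, hzg⟩
      rw [hB] at this; exact notMem_empty _ this
    apply hT i j hij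
    rw [← above_eq_of_mem_core h3 (hp i) (hM i) hzi hzE, above_eq_of_mem_core h3 (hp j) (hM j) hzj hzE]
  · obtain ⟨i, j, hij, hdi, hdj⟩ := hcover a ha
    exact ⟨i, j, hij, by rw [pres]; exact memb hij hdi hdj⟩
  · rintro ⟨i, j, hij, rfl⟩
    obtain ⟨d, hdi, hdj⟩ := hmeet i j hij
    rw [pres, ← memb hij hdi hdj]
    exact above_subset A _ hdi

end Triples

end Summit.CriticalPhenomena.PercolationContinuityZ3.Theorems.SahiColouredDaykin
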